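import Summits.NavierStokesRegularity.NavierStokesRegularity.Theorems.AxisymmetricExtremalityAxisymmetricKatoGlobalStubSeregin2020TypeIINoSwirlCoreVelocityLocal
import HarnessLib

/-!
# SwirlFreeBudget, brick for crux K-18.2 (T-18.5): a field is bounded by its curl bound and its
# local ENERGY on a ball, at a fixed scale (seat nsreg-p4)

Support file for the DORMANT route `SwirlThreshold` (crux stmt-NavierStokesRegularity-2002) and
planner nsreg-p2's ROUND-18 assembly task T-18.5 (`EtaMoserBound → SwirlFreePolynomialBound`).
The tree's local Helmholtz sup bound
(`…AxisymmetricKatoGlobal.EulerScaling.exists_const_norm_le_of_curl_le_local`: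
`‖v(x)‖ ≤ 2Λs + C s⁻³ ∫_{B̄(x,2s)} ‖v‖`) is turned into the ENERGY form the CKN gauge `A` delivers:
for `V` of class `C²` and divergence free on `ball c R` with `‖curl V‖ ≤ Λ` there and `‖V‖²`
integrable on `ball c R`,

  `‖V x‖ ≤ Λ R/2 + 64 C R⁻³ (vol(ball c R) + ∫_{ball c R} ‖V‖²)`  for all `x ∈ ball c (R/4)`

(`exists_const_norm_le_of_curl_le_energy`; `s = R/4`, `‖V‖ ≤ 1 + ‖V‖²`).  The dimensionally
inhomogeneous form is deliberate: the consumer works at the fixed scales of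
`SwirlFreePolynomialBound`.  With the local dictionary (`…SwirlFreeBudgetLocalDictionary`:
`‖curl V‖ ≤ Λ_η R` from `|ω_θ/r| ≤ Λ_η`) this is the analytic core of the smooth case of K-18.2.

WHAT THIS IS NOT: not NS regularity — an elliptic/kinematic estimate on one slice; `EtaMoserBound`,
`SwirlFreePolynomialBound` and all hard cores untouched; no crux claim.
-/

namespace Summit.NavierStokesRegularity.NavierStokesRegularity.Theorems.SwirlFreeBudget

open Set Filter Topology Metric MeasureTheory
open Literature.Analysis Literature.Analysis.FluidPDE
open Summit.NavierStokesRegularity.NavierStokesRegularity.Theorems.AxisymmetricKatoGlobal.EulerScaling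
  (exists_const_norm_le_of_curl_le_local)

noncomputable section

/-- **VELOCITY FROM A CURL BOUND AND LOCAL ENERGY (one slice, fixed scale).**  There is an
absolute `C ≥ 0` such that for `R > 0`, `V` of class `C²` and divergence free on `ball c R` with
`‖curl V‖ ≤ Λ` there and `‖V‖²` integrable on `ball c R`:
`‖V x‖ ≤ Λ R/2 + 64 C R⁻³ (vol(ball c R) + ∫_{ball c R} ‖V‖²)` for every `x ∈ ball c (R/4)`. -/
theorem exists_const_norm_le_of_curl_le_energy :
    ∃ C : ℝ, 0 ≤ C ∧ ∀ (V : EuclideanSpace ℝ (Fin 3) → EuclideanSpace ℝ (Fin 3))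
      (c : EuclideanSpace ℝ (Fin 3)) (R Λ : ℝ), 0 < R →
      (∀ y ∈ ball c R, ContDiffAt ℝ 2 V y) →
      (∀ y ∈ ball c R, VectorCalculus.divergence V y = 0) →
      (∀ y ∈ ball c R, ‖curl V y‖ ≤ Λ) →
      IntegrableOn (fun y => ‖V y‖ ^ 2) (ball c R) →
      ∀ x ∈ ball c (R / 4),
        ‖V x‖ ≤ Λ * R / 2 +
          64 * C * (R ^ 3)⁻¹ * ((volume (ball c R)).toReal + ∫ y in ball c R, ‖V y‖ ^ 2) := by
  obtain ⟨C, hC0, hC⟩ := exists_const_norm_le_of_curl_le_local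
  refine ⟨C, hC0, fun V c R Λ hR hV hdiv hcurl hint x hx => ?_⟩
  set s : ℝ := R / 4 with hs
  have hs0 : 0 < s := by positivity
  have hxc : dist x c < R / 4 := mem_ball.1 hx
  -- `ball x (3s) ⊆ ball c R` and `closedBall x (2s) ⊆ ball c R`
  have hsub3 : ball x (3 * s) ⊆ ball c R := by
    intro y hy
    rw [mem_ball] at hy ⊢
    calc dist y c ≤ dist y x + dist x c := dist_triangle _ _ _
      _ < 3 * s + R / 4 := by linarith
      _ = R := by rw [hs]; ring
  have hsub2 : closedBall x (2 * s) ⊆ ball c R := by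
    intro y hy
    rw [mem_closedBall] at hy
    rw [mem_ball]
    calc dist y c ≤ dist y x + dist x c := dist_triangle _ _ _
      _ < 2 * s + R / 4 := by linarith
      _ ≤ R := by rw [hs]; linarith
  have hmain := hC V x s Λ hs0 (fun y hy => hV y (hsub3 hy)) (fun y hy => hdiv y (hsub3 hy))
    (fun y hy => hcurl y (hsub3 hy))
  -- `∫_{B̄(x,2s)} ‖V‖ ≤ ∫_{ball c R} ‖V‖ ≤ vol + ∫ ‖V‖²`
  have hVc : ContinuousOn V (ball c R) := fun y hy => (hV y hy).continuousAt.continuousWithinAt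
  have hmeas : AEStronglyMeasurable V (volume.restrict (ball c R)) :=
    hVc.aestronglyMeasurable measurableSet_ball
  have hfin : volume (ball c R) < ⊤ := measure_ball_lt_top
  have hconst : IntegrableOn (fun _ : EuclideanSpace ℝ (Fin 3) => (1 : ℝ)) (ball c R) :=
    integrableOn_const hfin.ne
  have hint1 : IntegrableOn (fun y => ‖V y‖) (ball c R) := by
    refine Integrable.mono' (hconst.add hint) hmeas.norm ?_
    refine Eventually.of_forall fun y => ?_
    rw [Real.norm_eq_abs, abs_of_nonneg (norm_nonneg _)]
    show ‖V y‖ ≤ (1 : ℝ) + ‖V y‖ ^ 2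
    nlinarith [norm_nonneg (V y), sq_nonneg (‖V y‖ - 1)]
  have hL1 : ∫ y in closedBall x (2 * s), ‖V y‖ ≤
      (volume (ball c R)).toReal + ∫ y in ball c R, ‖V y‖ ^ 2 := by
    calc ∫ y in closedBall x (2 * s), ‖V y‖ ≤ ∫ y in ball c R, ‖V y‖ :=
          setIntegral_mono_set hint1 (Eventually.of_forall fun y => norm_nonneg _)
            (Eventually.of_forall hsub2)
      _ ≤ ∫ y in ball c R, ((1 : ℝ) + ‖V y‖ ^ 2) := by
          refine setIntegral_mono_on hint1 (hconst.add hint) measurableSet_ball fun y _ => ?_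
          nlinarith [norm_nonneg (V y), sq_nonneg (‖V y‖ - 1)]
      _ = (volume (ball c R)).toReal + ∫ y in ball c R, ‖V y‖ ^ 2 := by
          rw [integral_add hconst hint, setIntegral_const, smul_eq_mul, mul_one]
          rfl
  -- assemble
  have hs3 : (s ^ 3)⁻¹ = 64 * (R ^ 3)⁻¹ := by
    rw [hs]; field_simp; ring
  have hnn : 0 ≤ (volume (ball c R)).toReal + ∫ y in ball c R, ‖V y‖ ^ 2 :=
    add_nonneg ENNReal.toReal_nonneg (setIntegral_nonneg measurableSet_ball fun y _ => sq_nonneg _)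
  calc ‖V x‖ ≤ 2 * Λ * s + C * (s ^ 3)⁻¹ * ∫ y in closedBall x (2 * s), ‖V y‖ := hmain
    _ ≤ 2 * Λ * s + C * (s ^ 3)⁻¹ * ((volume (ball c R)).toReal + ∫ y in ball c R, ‖V y‖ ^ 2) := by
        gcongr
    _ = Λ * R / 2 + 64 * C * (R ^ 3)⁻¹ * ((volume (ball c R)).toReal + ∫ y in ball c R, ‖V y‖ ^ 2) := by
        rw [hs3, hs]; ring

end

end Summit.NavierStokesRegularity.NavierStokesRegularity.Theorems.SwirlFreeBudget
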